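import Summits.QuantumFields.BalabanUV.Beta.GAN24.CombHalfMemberSlavedDivergenceLetters
import Summits.QuantumFields.BalabanUV.Beta.GAN24.CombHalfMemberSlavedDivergenceDrift
import Summits.QuantumFields.BalabanUV.Beta.GAN24.CombHalfMemberSlavedDivergenceDriftSnd
import Summits.QuantumFields.BalabanUV.Beta.GAN24.CombRelSourceHalfCharge
import Summits.QuantumFields.BalabanUV.Beta.GAN24.T2DriftHalfMemberOfLetterRows

/-!
# `BalabanUV.Beta.GAN24.CombSlavedDivRowsOfWardLetters` — binder row G-an2-4 ∕ (CONV-C), TRANSFER-III (the (α-0) chain at row D1's literal of record (III′)), links L8b ∕ L11: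
# **THE SLAVED SLOT-DIVERGENCE ROWS OF THE COMB-CHART `ε`-MEMBERS AND OF THEIR DRIFTS — ALL LEVELS, ONE CONSTANT PER FAMILY, ONE RATE, GEOMETRIC DRIFTS — FROM THE
# DISPLAYED TABLE LAWS, THE SOURCE ROWS AND THE S-STEP SLOT LETTER ROWS** — the four row families `Hh₁ Hh₂ Hh₁d Hh₂d` that gan24-formalise-leaf-03 g81's junction W4
# `CombLegRowsOfNaturalWindows.exists_legRows_halfMember_comb_three_of_naturalWindows` DISPLAYS («`Hh₁ … Hh₂d` are leaf-01 g80's (b1)-at-(III′) chain's currency»), i.e. the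
# (III′) twin of leaf-03 g69's (E) FILE 4 `SlavedDivRowsOfWardLetters.exists_slavedDivRows_halfMember_three_of_wardLetters`, assembled from MY g80 (b1)-at-(III′) twins
# (G-an2-4 CRUX TEAM (2), leaf prover `b2b-balaban-gan24-formalise-leaf-01`, gen 82; the OWNER gan24-p1 g48's `gen48/README.md` «What is left» §2 names «the slaved divergence
# rows `Hh₁ … Hh₂d` (leaf-01's (b1)-at-(III′) chain)» as leaf-01's first refusal; no existing file touched)

NOT IN PRINT; OUR BOOKKEEPING ([folklore] composition BY NAME — the merge half of the (E) FILE 4's own proof with every chart-(II) supplier replaced by its DISPLAYED (III′) row;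
0 `def`, 0 cited facts, 0 `def … : Prop`, 0 sorry).  HONEST FRAMING (cell contract, verbatim): «discharging `BetaPertH` makes Bałaban's UV stability UNCONDITIONAL — a real
constructive-QFT result; it is NOT the continuum limit and NOT the Clay problem.»  HONEST DEPENDENCY (verbatim): «continuum YM on T⁴ ⇐ BetaPertH ∧ nine spine estimates
(0/9 proved); BetaPertH ⇐ (D1) ∧ (D4) ∧ CAP+tail; G-an2-4 gates asym, D1 and NE2/3/4.»

WHAT (generic `d`, `Lc ≥ 1` via `[NeZero Lc]`, ANY record `tabs : SymTables d Lc` with off-diagonal border `hBff hBmm`, every `cE cVH cΛ cE₂ cB Tc`, every `ε` with `|ε| ≤ 1`;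
the comb-chart unit member `T̃′♮_n := unitS₂_n (T2RecOf d Lc (GcombSh Lc) (SpureCombOf tabs cE cVH cΛ) tabs.M cE₂ cB Tc tabs.vh₂S tabs.mixFF n)`, its `ε`-half
`y′_n := ½ • (T̃′♮_n + ε • P T̃′♮_n)`, `G′♮_n := unitK_n (GcombSh Lc n)`):
**`exists_slavedDivRows_halfMember_comb_of_wardLetters`** — `∃ δ₃ σ₁ σ₂ σ₁d σ₂d ν₃, 0 < δ₃ ∧ 0 ≤ ν₃ < 1 ∧ (∀ n, LocStencil₂ (fun _ p κ′ u′ ↦ divV (κ₁ u₁ ↦ y′_n κ₁ u₁ κ′ u′) p) σ₁ δ₃)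
∧ (∀ n, LocStencil₂ (fun κ u _ p ↦ divV (κ₁ u₁ ↦ y′_n κ u κ₁ u₁) p) σ₂ δ₃) ∧ (∀ n, … (y′_{n+1} − y′_n) … (σ₁d·ν₃^n) δ₃) ∧ (∀ n, … (σ₂d·ν₃^n) δ₃)` — W4's `Hh₁ Hh₂ Hh₁d Hh₂d`
VERBATIM (instantiate `d := 3`) — from EXACTLY these DISPLAYED rows: (a) per level `l` the table laws `hTL l ∕ hTL'' l` of `T̃′_l` in the `[S_l, X_Y] + R_l` shape with
generic letters `S : ℕ → …`, `X`, `R R'' : ℕ → …`, lock constants `cH l ≠ 0` (at (III′) an2's slot-generic `WardLocusQuarticTableSlot.tableLaw_T2RecOf_succ ∕ _zero` shape,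
`X Y = diagK (ξ • Σ_{v∈box} legInd ρ (Lc•Y+v))`), with the parities `hC` (commutator word EVEN) and `hR hR''` (residual words ODD); (b) road-P2's two source rows in W4's
spelling — `Hb : ∀ n, LocStencil₂ (b̃′♮_n) Cb δ6` and the one-step Cauchy row `Hbd : ∀ l, LocStencil₂ (b̃′♮_{l+1} − b̃′♮_l) (cb·θb^l) δ6` of the dressed comb-chart source
`b̃′♮_n := (cE₂·Lc^{2(d+1)}) • mmRead (K3OfK G′♮_n S̃′♮_n M̃_n (W2SymOfK G′♮_n S̃′♮_n M̃_n 0 M̃₂,n)) + cB • tabs.vh₂S`; (c) the S-step slot letter rows of MY g80 PART 4′ ∕ 6′ ∕ 6b′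
(`CombHalfMemberSlavedDivergenceLetters ∕ Drift ∕ DriftSnd`) on the slaved `e3OfK` summands — `hE : ∀ l, hE₁(l) ∧ hE₂(l)` with ONE `(CE₁, CE₂, δE)` and their one-step drifts
`hEd : ∀ m, hEd₁(m) ∧ hEd₂(m)` with constants `CEd₁·θE^m ∕ CEd₂·θE^m` at `δE'`.  INSIDE, BY NAME: member `0` by MY g80 `CombRelSourceHalfCharge.locStencil₂_unitS₂_T2RecOf_comb`
⨾ the OWNER's `locStencil₂_halfTable` ⨾ leaf-03's `letterRow_fst ∕ snd_of_locStencil₂`; members `l+1` by PART 4′ `slotLetters_halfMember_comb_succ_of_rows`; drifts `l = m+1` by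
PART 6′ ∕ 6b′ `slotLetters_halfMember_comb_succ_sub_of_rows ∕ slotLetters_snd_halfMember_comb_succ_sub_of_rows`, `l = 0` by `locStencil₂_diff`; merged by leaf-03 g66's generic
`rows_of_zero_succ ∕ driftRows_of_zero_succ` (`δ₃ := min δ6 (min (min δE δE') δT)`, `ν₃ := max ½ (max θb θE)`) — the (E) FILE 4's text token for token.
WHAT THIS IS NOT.  Rows (a)(b)(c) are DISPLAYED HYPOTHESES — at (E) they are theorems (d1's raw table laws at the pins, p2's F4 `T2RecSourceRows`, p2 g45's
`BlockCommutatorStepLetter{,Drift}`); at (III′) their suppliers are the campaign's (an2's slot-generic table laws at `GcombSh`, road-P2's source-row socket ∕ S′-campaign, a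
(III′) twin of p2's S-step letter socket over leaf-02's `KSlotCombChart`) — NOT typed here; asserts NO value of any charge and NO shape of Bałaban's tables beyond the displayed
rows; NOTHING of (Q-L) ∕ (C) ∕ (C)sym ∕ `hcell ∕ hcelld` ∕ one S-∕W-slot row discharged; the (III′) campaign is NOT asked (an2 W-4 l.64553) — zero weight; NEVER «G-an2-4
closed» as (CONV-C); NOT D1, NOT `BetaPertH`, NOT continuum, NOT Clay; not in print.  2026-08-25.
-/

noncomputable section

open Finset
open scoped BigOperators
open Literature.MathematicalPhysics.QuantumFieldTheory
open Literature.MathematicalPhysics.QuantumFieldTheory.Balaban1983to89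
open Literature.MathematicalPhysics.QuantumFieldTheory.Balaban1983to89.Beta
open ExpKernelCalculus (MKer comp)
open OneStepResolventKernel (Fib)
open SecondOrderResponse (W2SymOfK)
open BalabanStepJetsSucc (mmRead)
open BalabanStepW2 (K3OfK M2Of)
open KernelWard (divV)
open AffineAveraging (box toSite)
open BalabanCompositeJets (LocStencil₂ LocStencil₂.nonneg)
open Summit.QuantumFields.BalabanUV.Beta.TameKernelCalculus (trK)
open Summit.QuantumFields.BalabanUV.Beta.BorderedHessian (sgnK)
open Summit.QuantumFields.BalabanUV.Beta.HessKerDressedUnits (unitK unitS)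
open Summit.QuantumFields.BalabanUV.Beta.SecondOrderUnits (unitM unitS₂ unitM₂)
open Summit.QuantumFields.BalabanUV.Beta.SpineRooted (T2RecOf e3OfK)
open Summit.QuantumFields.BalabanUV.Beta.SymmetrisedStepJets (SymTables)
open Summit.QuantumFields.BalabanUV.Beta.CombChartStepJets (GcombSh SpureCombOf)
open Summit.QuantumFields.BalabanUV.Beta.GAN24.CombesThomas (sfStep smStep)
open Summit.QuantumFields.BalabanUV.Beta.GAN24.WSlotCauchyOfShapes (locStencil₂_le_mono)
open Summit.QuantumFields.BalabanUV.Beta.GAN24.TableDressingDefect (locStencil₂_diff)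
open Summit.QuantumFields.BalabanUV.Beta.GAN24.T2ShapeEvenEnd (locStencil₂_halfTable)
open Summit.QuantumFields.BalabanUV.Beta.GAN24.HalfMemberCellOfDivergences (letterRow_fst_of_locStencil₂ letterRow_snd_of_locStencil₂)
open Summit.QuantumFields.BalabanUV.Beta.GAN24.CombHalfMemberSlavedDivergenceLetters (slotLetters_halfMember_comb_succ_of_rows)
open Summit.QuantumFields.BalabanUV.Beta.GAN24.CombHalfMemberSlavedDivergenceDrift (slotLetters_halfMember_comb_succ_sub_of_rows)
open Summit.QuantumFields.BalabanUV.Beta.GAN24.CombHalfMemberSlavedDivergenceDriftSnd (slotLetters_snd_halfMember_comb_succ_sub_of_rows)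
open Summit.QuantumFields.BalabanUV.Beta.GAN24.CombRelSourceHalfCharge (locStencil₂_unitS₂_T2RecOf_comb)
open Summit.QuantumFields.BalabanUV.Beta.GAN24.T2ShapeHalfMemberOfLetterRows (rows_of_zero_succ)
open Summit.QuantumFields.BalabanUV.Beta.GAN24.T2DriftHalfMemberOfLetterRows (driftRows_of_zero_succ fstTab_sub sndTab_sub)

namespace Summit.QuantumFields.BalabanUV.Beta.GAN24.CombSlavedDivRowsOfWardLetters

variable {d : ℕ} {Lc : ℕ} [NeZero Lc]

/-- NOT IN PRINT; OUR BOOKKEEPING.  **THE SLAVED SLOT-DIVERGENCE ROWS OF THE COMB-CHART `ε`-MEMBERS AND OF THEIR DRIFTS** (generic `d`, any `tabs : SymTables d Lc` with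
off-diagonal border, `|ε| ≤ 1`): all levels, one constant per family, one rate, geometric drifts — W4's `Hh₁ Hh₂ Hh₁d Hh₂d` — from the DISPLAYED per-level table laws `hTL hTL''`
(generic letters `S X R R'' cH`, parities `hC hR hR''`), the source rows `Hb Hbd` (W4's spelling) and the S-step slot letter rows `hE` ∕ drifts `hEd` (MY g80 PART 4′ ∕ 6′ ∕ 6b′
shapes); member `0` by `locStencil₂_unitS₂_T2RecOf_comb`, members `l+1` ∕ drifts by PART 4′ ∕ 6′ ∕ 6b′, merged by `rows_of_zero_succ ∕ driftRows_of_zero_succ`.  The (III′) twin of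
leaf-03 g69's `exists_slavedDivRows_halfMember_three_of_wardLetters` with its chart-(II) suppliers displayed. -/
theorem exists_slavedDivRows_halfMember_comb_of_wardLetters (tabs : SymTables d Lc) (cE cVH cΛ cE₂ cB : ℝ) (Tc : Fin 4 → Fin 4 → Fin 4 → Fin 4 → ℝ)
    (hBff : ∀ κ u κ' u' x z (α β : Fin (d + 1)), tabs.vh₂S κ u κ' u' x z (Sum.inl α) (Sum.inl β) = 0)
    (hBmm : ∀ κ u κ' u' x z (μ ν : Fin (d + 1)), tabs.vh₂S κ u κ' u' x z (Sum.inr μ) (Sum.inr ν) = 0)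
    {X : (Fin (d + 1) → ℤ) → MKer (d + 1) (Fib d)}
    {S : ℕ → Fin (d + 1) → (Fin (d + 1) → ℤ) → MKer (d + 1) (Fib d)}
    {R R'' : ℕ → (Fin (d + 1) → ℤ) → Fin (d + 1) → (Fin (d + 1) → ℤ) → MKer (d + 1) (Fib d)} {cH : ℕ → ℝ} (hcH0 : ∀ l, cH l ≠ 0)
    (hTL : ∀ (l : ℕ) (Y : Fin (d + 1) → ℤ) (κ' : Fin (d + 1)) (u' : Fin (d + 1) → ℤ),
      cH l • ∑ v ∈ box (d + 1) Lc, divV (fun κ u => T2RecOf d Lc (GcombSh Lc) (SpureCombOf tabs cE cVH cΛ) tabs.M cE₂ cB Tc tabs.vh₂S tabs.mixFF l κ u κ' u') ((Lc : ℤ) • Y + toSite v)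
        = comp (S l κ' u') (X Y) - comp (X Y) (S l κ' u') + R l Y κ' u')
    (hTL'' : ∀ (l : ℕ) (Y : Fin (d + 1) → ℤ) (κ : Fin (d + 1)) (u : Fin (d + 1) → ℤ),
      cH l • ∑ v ∈ box (d + 1) Lc, divV (T2RecOf d Lc (GcombSh Lc) (SpureCombOf tabs cE cVH cΛ) tabs.M cE₂ cB Tc tabs.vh₂S tabs.mixFF l κ u) ((Lc : ℤ) • Y + toSite v)
        = comp (S l κ u) (X Y) - comp (X Y) (S l κ u) + R'' l Y κ u)
    (hC : ∀ (l : ℕ) (Y : Fin (d + 1) → ℤ) (κ : Fin (d + 1)) (u : Fin (d + 1) → ℤ),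
      trK (comp (S l κ u) (X Y) - comp (X Y) (S l κ u)) = sgnK (comp (S l κ u) (X Y) - comp (X Y) (S l κ u)))
    (hR : ∀ (l : ℕ) (Y : Fin (d + 1) → ℤ) (κ : Fin (d + 1)) (u : Fin (d + 1) → ℤ), trK (R l Y κ u) = -sgnK (R l Y κ u))
    (hR'' : ∀ (l : ℕ) (Y : Fin (d + 1) → ℤ) (κ : Fin (d + 1)) (u : Fin (d + 1) → ℤ), trK (R'' l Y κ u) = -sgnK (R'' l Y κ u))
    (ε : ℝ) (hε : |ε| ≤ 1)
    {δ6 Cb cb θb : ℝ} (hδ6 : 0 < δ6) (hθb0 : 0 ≤ θb) (hθb1 : θb < 1)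
    (Hb : ∀ n : ℕ, LocStencil₂ (fun κ u κ' u' => (cE₂ * (Lc : ℝ) ^ (2 * (d + 1))) • mmRead Lc (K3OfK (unitK (sfStep Lc n) (smStep d Lc n) (GcombSh (d := d) Lc n)) Lc (unitS (sfStep Lc n) (smStep d Lc n) (SpureCombOf tabs cE cVH cΛ n)) (unitM (sfStep Lc n) (smStep d Lc n) (tabs.M n)) (W2SymOfK (unitK (sfStep Lc n) (smStep d Lc n) (GcombSh (d := d) Lc n)) Lc (unitS (sfStep Lc n) (smStep d Lc n) (SpureCombOf tabs cE cVH cΛ n)) (unitM (sfStep Lc n) (smStep d Lc n) (tabs.M n)) 0 (unitM₂ (sfStep Lc n) (smStep d Lc n) (M2Of d Lc tabs.mixFF n))) κ u κ' u') + cB • tabs.vh₂S κ u κ' u') Cb δ6)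
    (Hbd : ∀ l : ℕ, LocStencil₂ ((fun κ u κ' u' => (cE₂ * (Lc : ℝ) ^ (2 * (d + 1))) • mmRead Lc (K3OfK (unitK (sfStep Lc (l + 1)) (smStep d Lc (l + 1)) (GcombSh (d := d) Lc (l + 1))) Lc (unitS (sfStep Lc (l + 1)) (smStep d Lc (l + 1)) (SpureCombOf tabs cE cVH cΛ (l + 1))) (unitM (sfStep Lc (l + 1)) (smStep d Lc (l + 1)) (tabs.M (l + 1))) (W2SymOfK (unitK (sfStep Lc (l + 1)) (smStep d Lc (l + 1)) (GcombSh (d := d) Lc (l + 1))) Lc (unitS (sfStep Lc (l + 1)) (smStep d Lc (l + 1)) (SpureCombOf tabs cE cVH cΛ (l + 1))) (unitM (sfStep Lc (l + 1)) (smStep d Lc (l + 1)) (tabs.M (l + 1))) 0 (unitM₂ (sfStep Lc (l + 1)) (smStep d Lc (l + 1)) (M2Of d Lc tabs.mixFF (l + 1)))) κ u κ' u') + cB • tabs.vh₂S κ u κ' u')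
      - (fun κ u κ' u' => (cE₂ * (Lc : ℝ) ^ (2 * (d + 1))) • mmRead Lc (K3OfK (unitK (sfStep Lc l) (smStep d Lc l) (GcombSh (d := d) Lc l)) Lc (unitS (sfStep Lc l) (smStep d Lc l) (SpureCombOf tabs cE cVH cΛ l)) (unitM (sfStep Lc l) (smStep d Lc l) (tabs.M l)) (W2SymOfK (unitK (sfStep Lc l) (smStep d Lc l) (GcombSh (d := d) Lc l)) Lc (unitS (sfStep Lc l) (smStep d Lc l) (SpureCombOf tabs cE cVH cΛ l)) (unitM (sfStep Lc l) (smStep d Lc l) (tabs.M l)) 0 (unitM₂ (sfStep Lc l) (smStep d Lc l) (M2Of d Lc tabs.mixFF l))) κ u κ' u') + cB • tabs.vh₂S κ u κ' u')) (cb * θb ^ l) δ6)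
    {δE CE₁ CE₂ : ℝ} (hδE : 0 < δE)
    (hE : ∀ l : ℕ, LocStencil₂ (fun (_ : Fin (d + 1)) (p : Fin (d + 1) → ℤ) (κ' : Fin (d + 1)) (u' : Fin (d + 1) → ℤ) =>
          (cE₂ * (Lc : ℝ) ^ (2 * (d + 1)) * ((Lc : ℝ) ^ (d + 1))⁻¹ / 2) •
            (e3OfK Lc (unitK (sfStep Lc l) (smStep d Lc l) (GcombSh (d := d) Lc l))
              (fun κ' u' => (sfStep Lc l * smStep d Lc l)⁻¹ • unitS (sfStep Lc l) (smStep d Lc l)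
                (fun κ' u' => (cH l)⁻¹ • ((((1 : ℝ) + ε) / 2) • (comp (S l κ' u') (X p) - comp (X p) (S l κ' u')) + (((1 : ℝ) - ε) / 2) • R l p κ' u')) κ' u') κ' u'
            + e3OfK Lc (unitK (sfStep Lc l) (smStep d Lc l) (GcombSh (d := d) Lc l))
              (fun κ u => (sfStep Lc l * smStep d Lc l)⁻¹ • unitS (sfStep Lc l) (smStep d Lc l)
                (fun κ u => (cH l)⁻¹ • ((((1 : ℝ) + ε) / 2) • (comp (S l κ u) (X p) - comp (X p) (S l κ u)) + (((1 : ℝ) - ε) / 2) • R'' l p κ u)) κ u) κ' u')) CE₁ δE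
      ∧ LocStencil₂ (fun (κ : Fin (d + 1)) (u : Fin (d + 1) → ℤ) (_ : Fin (d + 1)) (p : Fin (d + 1) → ℤ) =>
          (cE₂ * (Lc : ℝ) ^ (2 * (d + 1)) * ((Lc : ℝ) ^ (d + 1))⁻¹ / 2) •
            (e3OfK Lc (unitK (sfStep Lc l) (smStep d Lc l) (GcombSh (d := d) Lc l))
              (fun κ' u' => (sfStep Lc l * smStep d Lc l)⁻¹ • unitS (sfStep Lc l) (smStep d Lc l)
                (fun κ' u' => (cH l)⁻¹ • ((((1 : ℝ) + ε) / 2) • (comp (S l κ' u') (X p) - comp (X p) (S l κ' u')) + (((1 : ℝ) - ε) / 2) • R l p κ' u')) κ' u') κ u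
            + e3OfK Lc (unitK (sfStep Lc l) (smStep d Lc l) (GcombSh (d := d) Lc l))
              (fun κ u => (sfStep Lc l * smStep d Lc l)⁻¹ • unitS (sfStep Lc l) (smStep d Lc l)
                (fun κ u => (cH l)⁻¹ • ((((1 : ℝ) + ε) / 2) • (comp (S l κ u) (X p) - comp (X p) (S l κ u)) + (((1 : ℝ) - ε) / 2) • R'' l p κ u)) κ u) κ u)) CE₂ δE)
    {δE' CEd₁ CEd₂ θE : ℝ} (hδE' : 0 < δE') (hθE0 : 0 ≤ θE) (hθE1 : θE < 1)
    (hEd : ∀ m : ℕ, LocStencil₂ (fun (_ : Fin (d + 1)) (p : Fin (d + 1) → ℤ) (κ' : Fin (d + 1)) (u' : Fin (d + 1) → ℤ) =>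
          (cE₂ * (Lc : ℝ) ^ (2 * (d + 1)) * ((Lc : ℝ) ^ (d + 1))⁻¹ / 2) •
            (e3OfK Lc (unitK (sfStep Lc (m + 1)) (smStep d Lc (m + 1)) (GcombSh (d := d) Lc (m + 1)))
              (fun κ' u' => (sfStep Lc (m + 1) * smStep d Lc (m + 1))⁻¹ • unitS (sfStep Lc (m + 1)) (smStep d Lc (m + 1))
                (fun κ' u' => (cH (m + 1))⁻¹ • ((((1 : ℝ) + ε) / 2) • (comp (S (m + 1) κ' u') (X p) - comp (X p) (S (m + 1) κ' u')) + (((1 : ℝ) - ε) / 2) • R (m + 1) p κ' u')) κ' u') κ' u'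
            + e3OfK Lc (unitK (sfStep Lc (m + 1)) (smStep d Lc (m + 1)) (GcombSh (d := d) Lc (m + 1)))
              (fun κ u => (sfStep Lc (m + 1) * smStep d Lc (m + 1))⁻¹ • unitS (sfStep Lc (m + 1)) (smStep d Lc (m + 1))
                (fun κ u => (cH (m + 1))⁻¹ • ((((1 : ℝ) + ε) / 2) • (comp (S (m + 1) κ u) (X p) - comp (X p) (S (m + 1) κ u)) + (((1 : ℝ) - ε) / 2) • R'' (m + 1) p κ u)) κ u) κ' u')
        - (cE₂ * (Lc : ℝ) ^ (2 * (d + 1)) * ((Lc : ℝ) ^ (d + 1))⁻¹ / 2) •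
            (e3OfK Lc (unitK (sfStep Lc m) (smStep d Lc m) (GcombSh (d := d) Lc m))
              (fun κ' u' => (sfStep Lc m * smStep d Lc m)⁻¹ • unitS (sfStep Lc m) (smStep d Lc m)
                (fun κ' u' => (cH m)⁻¹ • ((((1 : ℝ) + ε) / 2) • (comp (S m κ' u') (X p) - comp (X p) (S m κ' u')) + (((1 : ℝ) - ε) / 2) • R m p κ' u')) κ' u') κ' u'
            + e3OfK Lc (unitK (sfStep Lc m) (smStep d Lc m) (GcombSh (d := d) Lc m))
              (fun κ u => (sfStep Lc m * smStep d Lc m)⁻¹ • unitS (sfStep Lc m) (smStep d Lc m)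
                (fun κ u => (cH m)⁻¹ • ((((1 : ℝ) + ε) / 2) • (comp (S m κ u) (X p) - comp (X p) (S m κ u)) + (((1 : ℝ) - ε) / 2) • R'' m p κ u)) κ u) κ' u')) (CEd₁ * θE ^ m) δE'
      ∧ LocStencil₂ (fun (κ : Fin (d + 1)) (u : Fin (d + 1) → ℤ) (_ : Fin (d + 1)) (p : Fin (d + 1) → ℤ) =>
          (cE₂ * (Lc : ℝ) ^ (2 * (d + 1)) * ((Lc : ℝ) ^ (d + 1))⁻¹ / 2) •
            (e3OfK Lc (unitK (sfStep Lc (m + 1)) (smStep d Lc (m + 1)) (GcombSh (d := d) Lc (m + 1)))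
              (fun κ' u' => (sfStep Lc (m + 1) * smStep d Lc (m + 1))⁻¹ • unitS (sfStep Lc (m + 1)) (smStep d Lc (m + 1))
                (fun κ' u' => (cH (m + 1))⁻¹ • ((((1 : ℝ) + ε) / 2) • (comp (S (m + 1) κ' u') (X p) - comp (X p) (S (m + 1) κ' u')) + (((1 : ℝ) - ε) / 2) • R (m + 1) p κ' u')) κ' u') κ u
            + e3OfK Lc (unitK (sfStep Lc (m + 1)) (smStep d Lc (m + 1)) (GcombSh (d := d) Lc (m + 1)))
              (fun κ u => (sfStep Lc (m + 1) * smStep d Lc (m + 1))⁻¹ • unitS (sfStep Lc (m + 1)) (smStep d Lc (m + 1))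
                (fun κ u => (cH (m + 1))⁻¹ • ((((1 : ℝ) + ε) / 2) • (comp (S (m + 1) κ u) (X p) - comp (X p) (S (m + 1) κ u)) + (((1 : ℝ) - ε) / 2) • R'' (m + 1) p κ u)) κ u) κ u)
        - (cE₂ * (Lc : ℝ) ^ (2 * (d + 1)) * ((Lc : ℝ) ^ (d + 1))⁻¹ / 2) •
            (e3OfK Lc (unitK (sfStep Lc m) (smStep d Lc m) (GcombSh (d := d) Lc m))
              (fun κ' u' => (sfStep Lc m * smStep d Lc m)⁻¹ • unitS (sfStep Lc m) (smStep d Lc m)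
                (fun κ' u' => (cH m)⁻¹ • ((((1 : ℝ) + ε) / 2) • (comp (S m κ' u') (X p) - comp (X p) (S m κ' u')) + (((1 : ℝ) - ε) / 2) • R m p κ' u')) κ' u') κ u
            + e3OfK Lc (unitK (sfStep Lc m) (smStep d Lc m) (GcombSh (d := d) Lc m))
              (fun κ u => (sfStep Lc m * smStep d Lc m)⁻¹ • unitS (sfStep Lc m) (smStep d Lc m)
                (fun κ u => (cH m)⁻¹ • ((((1 : ℝ) + ε) / 2) • (comp (S m κ u) (X p) - comp (X p) (S m κ u)) + (((1 : ℝ) - ε) / 2) • R'' m p κ u)) κ u) κ u)) (CEd₂ * θE ^ m) δE') :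
    ∃ δ₃ σ₁ σ₂ σ₁d σ₂d ν₃ : ℝ, 0 < δ₃ ∧ 0 ≤ ν₃ ∧ ν₃ < 1 ∧
      (∀ n : ℕ, LocStencil₂ (fun (_ : Fin (d + 1)) (p : Fin (d + 1) → ℤ) (κ' : Fin (d + 1)) (u' : Fin (d + 1) → ℤ) =>
      divV (fun κ₁ u₁ => (((1 : ℝ) / 2) • (unitS₂ (sfStep Lc n) (smStep d Lc n) (T2RecOf d Lc (GcombSh Lc) (SpureCombOf tabs cE cVH cΛ) tabs.M cE₂ cB Tc tabs.vh₂S tabs.mixFF n) + ε • fun κ u κ' u' => sgnK (trK ((unitS₂ (sfStep Lc n) (smStep d Lc n) (T2RecOf d Lc (GcombSh Lc) (SpureCombOf tabs cE cVH cΛ) tabs.M cE₂ cB Tc tabs.vh₂S tabs.mixFF n)) κ u κ' u')))) κ₁ u₁ κ' u') p) σ₁ δ₃) ∧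
      (∀ n : ℕ, LocStencil₂ (fun (κ : Fin (d + 1)) (u : Fin (d + 1) → ℤ) (_ : Fin (d + 1)) (p : Fin (d + 1) → ℤ) =>
      divV (fun κ₁ u₁ => (((1 : ℝ) / 2) • (unitS₂ (sfStep Lc n) (smStep d Lc n) (T2RecOf d Lc (GcombSh Lc) (SpureCombOf tabs cE cVH cΛ) tabs.M cE₂ cB Tc tabs.vh₂S tabs.mixFF n) + ε • fun κ u κ' u' => sgnK (trK ((unitS₂ (sfStep Lc n) (smStep d Lc n) (T2RecOf d Lc (GcombSh Lc) (SpureCombOf tabs cE cVH cΛ) tabs.M cE₂ cB Tc tabs.vh₂S tabs.mixFF n)) κ u κ' u')))) κ u κ₁ u₁) p) σ₂ δ₃) ∧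
      (∀ n : ℕ, LocStencil₂ (fun (_ : Fin (d + 1)) (p : Fin (d + 1) → ℤ) (κ' : Fin (d + 1)) (u' : Fin (d + 1) → ℤ) =>
      divV (fun κ₁ u₁ => ((((1 : ℝ) / 2) • (unitS₂ (sfStep Lc (n + 1)) (smStep d Lc (n + 1)) (T2RecOf d Lc (GcombSh Lc) (SpureCombOf tabs cE cVH cΛ) tabs.M cE₂ cB Tc tabs.vh₂S tabs.mixFF (n + 1)) + ε • fun κ u κ' u' => sgnK (trK ((unitS₂ (sfStep Lc (n + 1)) (smStep d Lc (n + 1)) (T2RecOf d Lc (GcombSh Lc) (SpureCombOf tabs cE cVH cΛ) tabs.M cE₂ cB Tc tabs.vh₂S tabs.mixFF (n + 1))) κ u κ' u'))))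
        - (((1 : ℝ) / 2) • (unitS₂ (sfStep Lc n) (smStep d Lc n) (T2RecOf d Lc (GcombSh Lc) (SpureCombOf tabs cE cVH cΛ) tabs.M cE₂ cB Tc tabs.vh₂S tabs.mixFF n) + ε • fun κ u κ' u' => sgnK (trK ((unitS₂ (sfStep Lc n) (smStep d Lc n) (T2RecOf d Lc (GcombSh Lc) (SpureCombOf tabs cE cVH cΛ) tabs.M cE₂ cB Tc tabs.vh₂S tabs.mixFF n)) κ u κ' u'))))) κ₁ u₁ κ' u') p) (σ₁d * ν₃ ^ n) δ₃) ∧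
      (∀ n : ℕ, LocStencil₂ (fun (κ : Fin (d + 1)) (u : Fin (d + 1) → ℤ) (_ : Fin (d + 1)) (p : Fin (d + 1) → ℤ) =>
      divV (fun κ₁ u₁ => ((((1 : ℝ) / 2) • (unitS₂ (sfStep Lc (n + 1)) (smStep d Lc (n + 1)) (T2RecOf d Lc (GcombSh Lc) (SpureCombOf tabs cE cVH cΛ) tabs.M cE₂ cB Tc tabs.vh₂S tabs.mixFF (n + 1)) + ε • fun κ u κ' u' => sgnK (trK ((unitS₂ (sfStep Lc (n + 1)) (smStep d Lc (n + 1)) (T2RecOf d Lc (GcombSh Lc) (SpureCombOf tabs cE cVH cΛ) tabs.M cE₂ cB Tc tabs.vh₂S tabs.mixFF (n + 1))) κ u κ' u'))))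
        - (((1 : ℝ) / 2) • (unitS₂ (sfStep Lc n) (smStep d Lc n) (T2RecOf d Lc (GcombSh Lc) (SpureCombOf tabs cE cVH cΛ) tabs.M cE₂ cB Tc tabs.vh₂S tabs.mixFF n) + ε • fun κ u κ' u' => sgnK (trK ((unitS₂ (sfStep Lc n) (smStep d Lc n) (T2RecOf d Lc (GcombSh Lc) (SpureCombOf tabs cE cVH cΛ) tabs.M cE₂ cB Tc tabs.vh₂S tabs.mixFF n)) κ u κ' u'))))) κ u κ₁ u₁) p) (σ₂d * ν₃ ^ n) δ₃) := by
  -- member `0`: its own class (MY g80 (vii) §0 at level `0`)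
  obtain ⟨CT, δT, hδT, hT0⟩ := locStencil₂_unitS₂_T2RecOf_comb tabs cE cVH cΛ cE₂ cB Tc 0
  have hcb : 0 ≤ cb := by have h := (Hbd 0).nonneg; rwa [pow_zero, mul_one] at h
  -- THE COMMON RATE
  set δ₀ : ℝ := min δ6 (min (min δE δE') δT) with hδ₀def
  have hδ₀ : 0 < δ₀ := lt_min hδ6 (lt_min (lt_min hδE hδE') hδT)
  have hδ₀6 : δ₀ ≤ δ6 := min_le_left _ _
  have hδ₀E : δ₀ ≤ δE := ((min_le_right _ _).trans (min_le_left _ _)).trans (min_le_left _ _)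
  have hδ₀E' : δ₀ ≤ δE' := ((min_le_right _ _).trans (min_le_left _ _)).trans (min_le_right _ _)
  have hδ₀T : δ₀ ≤ δT := (min_le_right _ _).trans (min_le_right _ _)
  -- THE COMMON CONTRACTION FACTOR (`≥ ½` to absorb the level-`0` lag)
  set θ₁ : ℝ := max (1 / 2 : ℝ) (max θb θE) with hθ₁def
  have hθ₁h : (1 / 2 : ℝ) ≤ θ₁ := le_max_left _ _
  have hθ₁0 : 0 ≤ θ₁ := le_trans (by norm_num) hθ₁h
  have hθ₁1 : θ₁ < 1 := max_lt (by norm_num) (max_lt hθb1 hθE1)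
  have hθb₁ : θb ≤ θ₁ := (le_max_left _ _).trans (le_max_right _ _)
  have hθE₁ : θE ≤ θ₁ := (le_max_right _ _).trans (le_max_right _ _)
  -- LEVEL ROWS: member 0 by its own shape, members l+1 by PART 4′ at level l
  have h0 := locStencil₂_halfTable hT0 hε
  have h0₁ := letterRow_fst_of_locStencil₂ h0 hδT.le
  have h0₂ := letterRow_snd_of_locStencil₂ h0 hδT.le
  have hsucc := fun l => slotLetters_halfMember_comb_succ_of_rows tabs cE cVH cΛ cE₂ cB Tc hBff hBmm l (hcH0 l) (hTL l) (hTL'' l)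
    (hC l) (hR l) (hR'' l) ε hε hδ₀.le ((Hb l).mono hδ₀6) (((hE l).1).mono hδ₀E) (((hE l).2).mono hδ₀E)
  have h₁ := rows_of_zero_succ
    (T := fun l => (fun (_ : Fin (d + 1)) (p : Fin (d + 1) → ℤ) (κ' : Fin (d + 1)) (u' : Fin (d + 1) → ℤ) =>
      divV (fun κ₁ u₁ => (((1 : ℝ) / 2) • (unitS₂ (sfStep Lc l) (smStep d Lc l) (T2RecOf d Lc (GcombSh Lc) (SpureCombOf tabs cE cVH cΛ) tabs.M cE₂ cB Tc tabs.vh₂S tabs.mixFF l) + ε • fun κ u κ' u' => sgnK (trK ((unitS₂ (sfStep Lc l) (smStep d Lc l) (T2RecOf d Lc (GcombSh Lc) (SpureCombOf tabs cE cVH cΛ) tabs.M cE₂ cB Tc tabs.vh₂S tabs.mixFF l)) κ u κ' u')))) κ₁ u₁ κ' u') p))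
    h0₁ (fun l => (hsucc l).1) hδ₀T le_rfl
  have h₂ := rows_of_zero_succ
    (T := fun l => (fun (κ : Fin (d + 1)) (u : Fin (d + 1) → ℤ) (_ : Fin (d + 1)) (p : Fin (d + 1) → ℤ) =>
      divV (fun κ₁ u₁ => (((1 : ℝ) / 2) • (unitS₂ (sfStep Lc l) (smStep d Lc l) (T2RecOf d Lc (GcombSh Lc) (SpureCombOf tabs cE cVH cΛ) tabs.M cE₂ cB Tc tabs.vh₂S tabs.mixFF l) + ε • fun κ u κ' u' => sgnK (trK ((unitS₂ (sfStep Lc l) (smStep d Lc l) (T2RecOf d Lc (GcombSh Lc) (SpureCombOf tabs cE cVH cΛ) tabs.M cE₂ cB Tc tabs.vh₂S tabs.mixFF l)) κ u κ' u')))) κ u κ₁ u₁) p))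
    h0₂ (fun l => (hsucc l).2) hδ₀T le_rfl
  -- DRIFT ROWS, l = m+1: PART 6′ ∕ 6b′ at level m (the source's one-step Cauchy row, the letter drifts), then one constant `B·θ₁^m`
  have hK₁ : 0 ≤ ((d : ℝ) + 1) * (Real.exp (3 * δ₀) + 1) := by positivity
  have hK₂ : 0 ≤ ((d : ℝ) + 1) * (Real.exp δ₀ + 1) := by positivity
  have hds₁ : ∀ m, LocStencil₂ (fun (_ : Fin (d + 1)) (p : Fin (d + 1) → ℤ) (κ' : Fin (d + 1)) (u' : Fin (d + 1) → ℤ) =>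
      divV (fun κ₁ u₁ => ((((1 : ℝ) / 2) • (unitS₂ (sfStep Lc (m + 1 + 1)) (smStep d Lc (m + 1 + 1)) (T2RecOf d Lc (GcombSh Lc) (SpureCombOf tabs cE cVH cΛ) tabs.M cE₂ cB Tc tabs.vh₂S tabs.mixFF (m + 1 + 1)) + ε • fun κ u κ' u' => sgnK (trK ((unitS₂ (sfStep Lc (m + 1 + 1)) (smStep d Lc (m + 1 + 1)) (T2RecOf d Lc (GcombSh Lc) (SpureCombOf tabs cE cVH cΛ) tabs.M cE₂ cB Tc tabs.vh₂S tabs.mixFF (m + 1 + 1))) κ u κ' u'))))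
        - (((1 : ℝ) / 2) • (unitS₂ (sfStep Lc (m + 1)) (smStep d Lc (m + 1)) (T2RecOf d Lc (GcombSh Lc) (SpureCombOf tabs cE cVH cΛ) tabs.M cE₂ cB Tc tabs.vh₂S tabs.mixFF (m + 1)) + ε • fun κ u κ' u' => sgnK (trK ((unitS₂ (sfStep Lc (m + 1)) (smStep d Lc (m + 1)) (T2RecOf d Lc (GcombSh Lc) (SpureCombOf tabs cE cVH cΛ) tabs.M cE₂ cB Tc tabs.vh₂S tabs.mixFF (m + 1))) κ u κ' u'))))) κ₁ u₁ κ' u') p)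
      ((((d : ℝ) + 1) * (Real.exp (3 * δ₀) + 1) * cb + |CEd₁|) * θ₁ ^ m) δ₀ := by
    intro m
    have h := slotLetters_halfMember_comb_succ_sub_of_rows tabs cE cVH cΛ cE₂ cB Tc hBff hBmm m (hcH0 m) (hTL m) (hTL'' m)
      (hC m) (hR m) (hR'' m) (hcH0 (m + 1)) (hTL (m + 1)) (hTL'' (m + 1)) (hC (m + 1)) (hR (m + 1)) (hR'' (m + 1)) ε hε hδ₀.le
      ((Hbd m).mono hδ₀6) (((hEd m).1).mono hδ₀E')
    refine locStencil₂_le_mono h ?_ le_rfl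
    have hp1 : θb ^ m ≤ θ₁ ^ m := pow_le_pow_left₀ hθb0 hθb₁ m
    have hp2 : θE ^ m ≤ θ₁ ^ m := pow_le_pow_left₀ hθE0 hθE₁ m
    have a1 : ((d : ℝ) + 1) * (Real.exp (3 * δ₀) + 1) * (cb * θb ^ m) ≤ ((d : ℝ) + 1) * (Real.exp (3 * δ₀) + 1) * cb * θ₁ ^ m := by
      rw [mul_assoc _ cb]
      exact mul_le_mul_of_nonneg_left (mul_le_mul_of_nonneg_left hp1 hcb) hK₁
    have a2 : CEd₁ * θE ^ m ≤ |CEd₁| * θ₁ ^ m :=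
      (le_abs_self _).trans (by
        rw [abs_mul, abs_of_nonneg (pow_nonneg hθE0 m)]
        exact mul_le_mul_of_nonneg_left hp2 (abs_nonneg _))
    exact (add_le_add a1 a2).trans (le_of_eq (by ring))
  have hds₂ : ∀ m, LocStencil₂ (fun (κ : Fin (d + 1)) (u : Fin (d + 1) → ℤ) (_ : Fin (d + 1)) (p : Fin (d + 1) → ℤ) =>
      divV (fun κ₁ u₁ => ((((1 : ℝ) / 2) • (unitS₂ (sfStep Lc (m + 1 + 1)) (smStep d Lc (m + 1 + 1)) (T2RecOf d Lc (GcombSh Lc) (SpureCombOf tabs cE cVH cΛ) tabs.M cE₂ cB Tc tabs.vh₂S tabs.mixFF (m + 1 + 1)) + ε • fun κ u κ' u' => sgnK (trK ((unitS₂ (sfStep Lc (m + 1 + 1)) (smStep d Lc (m + 1 + 1)) (T2RecOf d Lc (GcombSh Lc) (SpureCombOf tabs cE cVH cΛ) tabs.M cE₂ cB Tc tabs.vh₂S tabs.mixFF (m + 1 + 1))) κ u κ' u'))))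
        - (((1 : ℝ) / 2) • (unitS₂ (sfStep Lc (m + 1)) (smStep d Lc (m + 1)) (T2RecOf d Lc (GcombSh Lc) (SpureCombOf tabs cE cVH cΛ) tabs.M cE₂ cB Tc tabs.vh₂S tabs.mixFF (m + 1)) + ε • fun κ u κ' u' => sgnK (trK ((unitS₂ (sfStep Lc (m + 1)) (smStep d Lc (m + 1)) (T2RecOf d Lc (GcombSh Lc) (SpureCombOf tabs cE cVH cΛ) tabs.M cE₂ cB Tc tabs.vh₂S tabs.mixFF (m + 1))) κ u κ' u'))))) κ u κ₁ u₁) p)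
      ((((d : ℝ) + 1) * (Real.exp δ₀ + 1) * cb + |CEd₂|) * θ₁ ^ m) δ₀ := by
    intro m
    have h := slotLetters_snd_halfMember_comb_succ_sub_of_rows tabs cE cVH cΛ cE₂ cB Tc hBff hBmm m (hcH0 m) (hTL m) (hTL'' m)
      (hC m) (hR m) (hR'' m) (hcH0 (m + 1)) (hTL (m + 1)) (hTL'' (m + 1)) (hC (m + 1)) (hR (m + 1)) (hR'' (m + 1)) ε hε hδ₀.le
      ((Hbd m).mono hδ₀6) (((hEd m).2).mono hδ₀E')
    refine locStencil₂_le_mono h ?_ le_rfl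
    have hp1 : θb ^ m ≤ θ₁ ^ m := pow_le_pow_left₀ hθb0 hθb₁ m
    have hp2 : θE ^ m ≤ θ₁ ^ m := pow_le_pow_left₀ hθE0 hθE₁ m
    have a1 : ((d : ℝ) + 1) * (Real.exp δ₀ + 1) * (cb * θb ^ m) ≤ ((d : ℝ) + 1) * (Real.exp δ₀ + 1) * cb * θ₁ ^ m := by
      rw [mul_assoc _ cb]
      exact mul_le_mul_of_nonneg_left (mul_le_mul_of_nonneg_left hp1 hcb) hK₂
    have a2 : CEd₂ * θE ^ m ≤ |CEd₂| * θ₁ ^ m :=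
      (le_abs_self _).trans (by
        rw [abs_mul, abs_of_nonneg (pow_nonneg hθE0 m)]
        exact mul_le_mul_of_nonneg_left hp2 (abs_nonneg _))
    exact (add_le_add a1 a2).trans (le_of_eq (by ring))
  -- DRIFT ROWS, all l: the first difference (levels 1 and 0, `locStencil₂_diff`) merged with the lagged rows
  have h₁' := driftRows_of_zero_succ
    (T := fun l => (fun (_ : Fin (d + 1)) (p : Fin (d + 1) → ℤ) (κ' : Fin (d + 1)) (u' : Fin (d + 1) → ℤ) =>
      divV (fun κ₁ u₁ => ((((1 : ℝ) / 2) • (unitS₂ (sfStep Lc (l + 1)) (smStep d Lc (l + 1)) (T2RecOf d Lc (GcombSh Lc) (SpureCombOf tabs cE cVH cΛ) tabs.M cE₂ cB Tc tabs.vh₂S tabs.mixFF (l + 1)) + ε • fun κ u κ' u' => sgnK (trK ((unitS₂ (sfStep Lc (l + 1)) (smStep d Lc (l + 1)) (T2RecOf d Lc (GcombSh Lc) (SpureCombOf tabs cE cVH cΛ) tabs.M cE₂ cB Tc tabs.vh₂S tabs.mixFF (l + 1))) κ u κ' u'))))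
        - (((1 : ℝ) / 2) • (unitS₂ (sfStep Lc l) (smStep d Lc l) (T2RecOf d Lc (GcombSh Lc) (SpureCombOf tabs cE cVH cΛ) tabs.M cE₂ cB Tc tabs.vh₂S tabs.mixFF l) + ε • fun κ u κ' u' => sgnK (trK ((unitS₂ (sfStep Lc l) (smStep d Lc l) (T2RecOf d Lc (GcombSh Lc) (SpureCombOf tabs cE cVH cΛ) tabs.M cE₂ cB Tc tabs.vh₂S tabs.mixFF l)) κ u κ' u'))))) κ₁ u₁ κ' u') p))
    (by simpa only [fstTab_sub] using locStencil₂_diff (hsucc 0).1 (h0₁.mono hδ₀T)) hds₁ (by positivity) hθ₁h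
  have h₂' := driftRows_of_zero_succ
    (T := fun l => (fun (κ : Fin (d + 1)) (u : Fin (d + 1) → ℤ) (_ : Fin (d + 1)) (p : Fin (d + 1) → ℤ) =>
      divV (fun κ₁ u₁ => ((((1 : ℝ) / 2) • (unitS₂ (sfStep Lc (l + 1)) (smStep d Lc (l + 1)) (T2RecOf d Lc (GcombSh Lc) (SpureCombOf tabs cE cVH cΛ) tabs.M cE₂ cB Tc tabs.vh₂S tabs.mixFF (l + 1)) + ε • fun κ u κ' u' => sgnK (trK ((unitS₂ (sfStep Lc (l + 1)) (smStep d Lc (l + 1)) (T2RecOf d Lc (GcombSh Lc) (SpureCombOf tabs cE cVH cΛ) tabs.M cE₂ cB Tc tabs.vh₂S tabs.mixFF (l + 1))) κ u κ' u'))))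
        - (((1 : ℝ) / 2) • (unitS₂ (sfStep Lc l) (smStep d Lc l) (T2RecOf d Lc (GcombSh Lc) (SpureCombOf tabs cE cVH cΛ) tabs.M cE₂ cB Tc tabs.vh₂S tabs.mixFF l) + ε • fun κ u κ' u' => sgnK (trK ((unitS₂ (sfStep Lc l) (smStep d Lc l) (T2RecOf d Lc (GcombSh Lc) (SpureCombOf tabs cE cVH cΛ) tabs.M cE₂ cB Tc tabs.vh₂S tabs.mixFF l)) κ u κ' u'))))) κ u κ₁ u₁) p))
    (by simpa only [sndTab_sub] using locStencil₂_diff (hsucc 0).2 (h0₂.mono hδ₀T)) hds₂ (by positivity) hθ₁h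
  exact ⟨δ₀, _, _, _, _, θ₁, hδ₀, hθ₁0, hθ₁1, h₁, h₂, h₁', h₂'⟩

end Summit.QuantumFields.BalabanUV.Beta.GAN24.CombSlavedDivRowsOfWardLetters

end
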